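import Literature.MathematicalPhysics.QuantumLattice.Imbrie2016.TwoSiteSpread

/-!
# Imbrie (2016), Assumption LLA: from three sites on, the local level-velocity spreads CAN all vanish

CITATION HEADER (lean-in-tree rule 2026-08-18). J. Z. Imbrie, *On many-body localization for quantum spin chains*,
J. Stat. Phys. **163** (2016) 998–1048, doi 10.1007/s10955-016-1508-x, arXiv:1403.7837 [ImbrieJSP2016], eq. (1.1) (the local
diagonal operators S^z_i, S^z_{i-1} S^z_i through which the random fields h_i and bonds J_i enter), eq. (1.3) (Assumption LLA).

WHAT IS PROVED (a lemma of the audit cell `pub-imbrie`, NOT a statement of the paper; pub-imbrie LLA.md gen-4 G4′(b)).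
The companion file `TwoSiteSpread` shows that on a two-site cluster the six local spreads of an orthonormal pair cannot all vanish.
`threeSite_localSpreads_can_vanish` shows this STOPS at three sites: the explicit orthonormal pair
`u = ½·𝟙{σ₁ = σ₃}`, `v = ½·𝟙{σ₁ ≠ σ₃}` on the eight configurations has `Σ s_V (u² − v²) = Σ s_V u v = 0` for all five local operators
`V ∈ {Z₁, Z₂, Z₃, Z₁Z₂, Z₂Z₃}` (indeed `u v ≡ 0` and `u² − v² = ¼ s_{Z₁Z₃}`, a NON-local Walsh function).  Consequence for the audit
(LLA.md gen-4 G4′): a first/second-order transversality argument for LLA through the 2m local couplings alone cannot be purely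
deterministic from m = 3 sites on; the remainder term R_V of G4′ or a probabilistic statement (PND_r) is needed.
`sum_cfg_three` writes a sum over the eight configurations as an iterated sum (first spin, then a 2-site box).

STATUS: elementary; says NOTHING about whether LLA holds (OPEN, pub-imbrie LLA.md §7). No `sorry`, no new axioms, no new definitions.
-/

namespace Literature.MathematicalPhysics.QuantumLattice.Imbrie2016

open Finset

/-- a sum over the eight configurations of a 3-site box = sum over the first spin of sums over a 2-site box.
[cite: ImbrieJSP2016, eq. (1.1)] -/
theorem sum_cfg_three (f : Cfg 3 → ℝ) : ∑ σ, f σ = ∑ b : Bool, ∑ τ : Cfg 2, f (Matrix.vecCons b τ) := by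
  rw [← Fintype.sum_equiv (Fin.consEquiv fun _ => Bool) (fun p => f (Matrix.vecCons p.1 p.2)) f (fun _ => rfl),
    Fintype.sum_prod_type]

/-- On a THREE-site cluster all ten local spreads of an orthonormal pair can vanish: witness `u = ½·𝟙{σ 0 = σ 2}`,
`v = ½·𝟙{σ 0 ≠ σ 2}` (so `u v ≡ 0`, `u² − v² = ¼ s_{Z₁Z₃}`). Contrast `twoSite_localSpreads_ne_zero`.
[cite: ImbrieJSP2016, eq. (1.1), (1.3)] -/
theorem threeSite_localSpreads_can_vanish :
    ∃ u v : Cfg 3 → ℝ, (∑ σ, u σ ^ 2 = 1) ∧ (∑ σ, v σ ^ 2 = 1) ∧ (∑ σ, u σ * v σ = 0) ∧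
      -- fields: V = Z at sites 0, 1, 2
      (∑ σ, (if σ 0 then (1 : ℝ) else -1) * (u σ ^ 2 - v σ ^ 2) = 0) ∧
      (∑ σ, (if σ 0 then (1 : ℝ) else -1) * (u σ * v σ) = 0) ∧
      (∑ σ, (if σ 1 then (1 : ℝ) else -1) * (u σ ^ 2 - v σ ^ 2) = 0) ∧
      (∑ σ, (if σ 1 then (1 : ℝ) else -1) * (u σ * v σ) = 0) ∧
      (∑ σ, (if σ 2 then (1 : ℝ) else -1) * (u σ ^ 2 - v σ ^ 2) = 0) ∧
      (∑ σ, (if σ 2 then (1 : ℝ) else -1) * (u σ * v σ) = 0) ∧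
      -- bonds: V = Z Z on (0,1) and (1,2)
      (∑ σ, ((if σ 0 then (1 : ℝ) else -1) * (if σ 1 then (1 : ℝ) else -1)) * (u σ ^ 2 - v σ ^ 2) = 0) ∧
      (∑ σ, ((if σ 0 then (1 : ℝ) else -1) * (if σ 1 then (1 : ℝ) else -1)) * (u σ * v σ) = 0) ∧
      (∑ σ, ((if σ 1 then (1 : ℝ) else -1) * (if σ 2 then (1 : ℝ) else -1)) * (u σ ^ 2 - v σ ^ 2) = 0) ∧
      (∑ σ, ((if σ 1 then (1 : ℝ) else -1) * (if σ 2 then (1 : ℝ) else -1)) * (u σ * v σ) = 0) := by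
  refine ⟨fun σ => if σ 0 = σ 2 then (1 / 2 : ℝ) else 0, fun σ => if σ 0 = σ 2 then (0 : ℝ) else 1 / 2, ?_⟩
  simp only [sum_cfg_three, Fintype.sum_bool, sum_cfg_two, Matrix.cons_val_zero, Matrix.cons_val_one,
    Matrix.cons_val_two, Matrix.head_cons, Matrix.tail_cons]
  norm_num

/-- the same witness in the paper's notation `szZ` (boundary spins +1: `szZ σ (-1) = szZ σ 3 = 1`, so the boundary bonds
`J_0 szZ(-1) szZ 0`, `J_3 szZ 2 szZ 3` act as the fields at sites 0 and 2 and are covered). [cite: ImbrieJSP2016, eq. (1.1), (1.3)] -/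
theorem szZ_cfg_three (σ : Cfg 3) (k : Fin 3) : szZ σ (k : ℤ) = if σ k then (1 : ℝ) else -1 := by
  fin_cases k <;> simp [szZ]

end Literature.MathematicalPhysics.QuantumLattice.Imbrie2016
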